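import Mathlib.LinearAlgebra.Finsupp.LSum
import Mathlib.Logic.Equiv.Basic
import Mathlib.Data.Fintype.Pi
import Mathlib.Algebra.BigOperators.Group.Finset.Basic
import HarnessLib

/-!
# Temperley–Lieb generators on perfect matchings / link patterns (loop weight `δ`; `δ = 1`: percolation)

First layer of the transfer-matrix / Temperley–Lieb formalism for critical bond percolation on a
strip (definition request `PercolationStripTransferMatrix` of route
`CriticalPhenomena/CardyFormula/CardySusyWard`). Source read: P. A. Pearce, V. Rittenberg,
J. de Gier, B. Nienhuis, *Temperley–Lieb stochastic processes*, J. Phys. A 35 (2002) L661–L668 =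
arXiv:math-ph/0209017 [`PearceRittenbergDeGierNienhuis2002`], §2: "the generators `eᵢ` of the
Temperley–Lieb algebra `T` […] `eᵢ² = (q + q⁻¹) eᵢ`, `eᵢ e_{i±1} eᵢ = eᵢ`, `[eᵢ, eⱼ] = 0` for
`|i - j| > 1`, with `1 ≤ i ≤ L - 1`. Restricting ourselves to the case `q = e^{iπ/3}` […] closed
contractible loops may be removed at the cost of a factor `q + q⁻¹ = 1`"; the graphical action on
link diagrams ("placing the graph of the generator under the […] word and erasing the intermediate
dashed line […] loop segments either form closed loops or pairwise connect sites"); the Hamiltonian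
"`H = Σ_{j=1}^{L-1} (1 - eⱼ)` […] closely related to the critical `Q = 1` Potts model (dense
`O(n = 1)` or Temperley–Lieb loop model) [Baxter–Kelland–Wu 1976, Martin 1990]"; and the link
patterns of the `0`-defect sector ("non-intersecting half-loops", of Catalan number dimension).

## Contents

* `PerfectMatching L` — fixed-point-free involutions of `Fin L` (pairings of the `L` boundary
  sites; `Fintype`, `DecidableEq`), `IsNonCrossing`, and `LinkPattern L` — the NON-CROSSING ones
  (the link patterns / "non-intersecting half-loops" spanning the `0`-defect sector; `Fintype`);
  `LinkPattern.arc` (the unique pattern on two sites).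
* `PerfectMatching.connect p a b` — the diagrammatic action of the monoid `e` at the sites `a, b`
  on a pairing: if `a, b` are already paired nothing changes (a loop closes), otherwise `a–b` become
  paired and their former partners become paired with each other; implemented as conjugation of
  `p` by the transposition `(a, p b)`, with `connect_partner_left/right`, `connect_of_partner_eq`.
* `tlGen δ a b` — the linear operator on the free module `PerfectMatching L →₀ R`:
  `δ_p ↦ δ • δ_p` if `p` pairs `a` with `b` (closed loop, weight `δ = q + q⁻¹`), else
  `δ_p ↦ δ_{connect p a b}`; `tlGen_single`, and **`tlGen_comp_tlGen : e ∘ e = δ • e`** (the first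
  Temperley–Lieb relation, proved); the nearest-neighbour family `tlE δ j` (`j : Fin n`, sites
  `j, j+1` of `Fin (n+1)`), `tlE_comp_tlE`, and the Hamiltonian `tlHamiltonian δ = Σⱼ (1 - eⱼ)`
  (printed (eq. ham) at `δ = 1`).
* `IsTemperleyLiebFamily δ e` — the three printed relations as a predicate on a family of
  endomorphisms `e : Fin n → Module.End R V` (the abstract algebra is not built).

## Not here (follow-ups for the same request)

The remaining two relations for `tlE` (`eⱼ e_{j±1} eⱼ = eⱼ`, far commutation — finite case analyses
on `connect`), invariance of the span of `LinkPattern` under `tlE` (planarity is preserved), the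
double-row transfer matrix `t_L(u)` with free sides and its `Ř`-matrix normalisation, the
spin-chain (`(ℂ²)^{⊗L}`, `Δ = -1/2`) representation, and the dictionary "rectangle crossing
probability under `bondPercolation (zdGraph 2) ½` = matrix element of `t_L(iso)^M`"
(Baxter–Kelland–Wu 1976 / Blöte–Nienhuis), which needs its printed source.

## References

* [PearceRittenbergDeGierNienhuis2002] P. A. Pearce, V. Rittenberg, J. de Gier, B. Nienhuis,
  J. Phys. A 35 (2002) L661–L668, doi:10.1088/0305-4470/35/45/105 = arXiv:math-ph/0209017, §2
  (eqs. (TL), (monoid), (ham); link diagrams, `C_{L,m}`, `I₀`).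
* H. N. V. Temperley, E. H. Lieb, Proc. R. Soc. London A 322 (1971) 251.
* R. J. Baxter, S. B. Kelland, F. Y. Wu, J. Phys. A 9 (1976) 397 (percolation / Potts ↔ six-vertex).
-/

noncomputable section

open Function Finsupp

namespace Literature.Probability.LatticeModels

namespace TemperleyLieb

variable {L : ℕ}

/-! ### Pairings of the boundary sites -/

/-- A **perfect matching (pairing)** of the `L` boundary sites `Fin L`: a fixed-point-free
involution `partner` (site `i` is linked to `partner i`). All link diagrams without defects are of
this form; the planar ones are the `LinkPattern`s (Pearce–Rittenberg–de Gier–Nienhuis 2002, §2: "the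
`2L` sites […] are pairwise connected by lines"). [cite: PearceRittenbergDeGierNienhuis2002, §2] -/
structure PerfectMatching (L : ℕ) where
  /-- The partner of a site. -/
  partner : Fin L → Fin L
  /-- Being partners is symmetric: `partner` is an involution. -/
  partner_partner : ∀ i, partner (partner i) = i
  /-- No site is its own partner. -/
  partner_ne : ∀ i, partner i ≠ i

namespace PerfectMatching

/-- Two pairings with the same partner function are equal. [folklore] -/
@[ext] theorem ext {p q : PerfectMatching L} (h : p.partner = q.partner) : p = q := by
  cases p; cases q; congr

/-- `partner` determines the pairing. [folklore] -/
theorem partner_injective : Injective (partner : PerfectMatching L → Fin L → Fin L) :=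
  fun _ _ h => ext h

/-- Equality of pairings is decidable (compare partner functions). [folklore] -/
instance instDecidableEq : DecidableEq (PerfectMatching L) := fun p q =>
  decidable_of_iff (p.partner = q.partner) ⟨fun h => ext h, fun h => h ▸ rfl⟩

/-- There are finitely many pairings of `Fin L` (injection into `Fin L → Fin L`). [folklore] -/
instance instFintype : Fintype (PerfectMatching L) :=
  Fintype.ofInjective partner partner_injective

/-- `partner` is injective on sites (it is an involution). [folklore] -/
theorem partner_inj (p : PerfectMatching L) {i j : Fin L} : p.partner i = p.partner j ↔ i = j :=
  ⟨fun h => by rw [← p.partner_partner i, h, p.partner_partner], fun h => h ▸ rfl⟩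

/-- **The diagrammatic action of the monoid `e` at the sites `a, b`** on a pairing `p`
(Pearce–Rittenberg–de Gier–Nienhuis 2002, (monoid): "placing the graph of the generator under the
[diagram] and erasing the intermediate dashed line"): if `a` and `b` are already partners nothing
changes (a closed loop forms); otherwise `a` and `b` become partners and their former partners
`p a`, `p b` become partners of each other. Both cases are the conjugate of `p` by the transposition
`(a, p b)` (which is the identity when `p b = a`). [cite: PearceRittenbergDeGierNienhuis2002, §2 (monoid)] -/
def connect (p : PerfectMatching L) (a b : Fin L) : PerfectMatching L where
  partner i := Equiv.swap a (p.partner b) (p.partner (Equiv.swap a (p.partner b) i))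
  partner_partner i := by simp [p.partner_partner]
  partner_ne i h := by
    have h' := congrArg (Equiv.swap a (p.partner b)) h
    rw [Equiv.swap_apply_self] at h'
    exact p.partner_ne _ h'

/-- The partner function after connecting `a, b`. [folklore] -/
theorem connect_partner (p : PerfectMatching L) (a b i : Fin L) :
    (p.connect a b).partner i =
      Equiv.swap a (p.partner b) (p.partner (Equiv.swap a (p.partner b) i)) :=
  rfl

/-- If `a` and `b` are already partners, connecting them changes nothing (a loop closes). [folklore] -/
theorem connect_of_partner_eq (p : PerfectMatching L) {a b : Fin L} (h : p.partner a = b) :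
    p.connect a b = p := by
  have hb : p.partner b = a := by rw [← h, p.partner_partner]
  ext i : 2
  simp [connect_partner, hb]

/-- After connecting `a ≠ b`, the partner of `a` is `b`. [folklore] -/
theorem connect_partner_left (p : PerfectMatching L) {a b : Fin L} (hab : a ≠ b) :
    (p.connect a b).partner a = b := by
  rw [connect_partner, Equiv.swap_apply_left, p.partner_partner,
    Equiv.swap_apply_of_ne_of_ne hab.symm (p.partner_ne b).symm]

/-- After connecting `a ≠ b`, the partner of `b` is `a`. [folklore] -/
theorem connect_partner_right (p : PerfectMatching L) {a b : Fin L} (hab : a ≠ b) :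
    (p.connect a b).partner b = a := by
  have h := (p.connect a b).partner_partner a
  rwa [connect_partner_left p hab] at h

/-- Connecting a site with itself changes nothing (the transposition `(a, p a)` commutes with
`p`). [folklore] -/
theorem connect_self (q : PerfectMatching L) (a : Fin L) : q.connect a a = q := by
  ext i : 2
  simp only [connect_partner, Equiv.swap_apply_def]
  by_cases h1 : i = a
  · subst h1
    simp [q.partner_partner]
  · by_cases h2 : i = q.partner a
    · subst h2
      simp [q.partner_partner, q.partner_ne]
    · have h3 : q.partner i ≠ a := fun h => h2 (by rw [← h, q.partner_partner])
      have h4 : q.partner i ≠ q.partner a := fun h => h1 (q.partner_inj.1 h)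
      simp [h1, h2, h3, h4]

/-- Connecting twice at the same sites is connecting once (the second application only closes a
loop). [folklore] -/
theorem connect_connect (p : PerfectMatching L) (a b : Fin L) :
    (p.connect a b).connect a b = p.connect a b := by
  by_cases hab : a = b
  · subst hab
    rw [connect_self, connect_self]
  · exact connect_of_partner_eq _ (connect_partner_left p hab)

end PerfectMatching

/-- A pairing is **non-crossing (planar)** if no two links `{a, p a}`, `{b, p b}` interlace:
whenever `b` lies strictly inside the link `a < p a`, so does its partner. These are the link
patterns drawn with "non-intersecting half-loops" (Pearce–Rittenberg–de Gier–Nienhuis 2002, §2).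
[cite: PearceRittenbergDeGierNienhuis2002, §2] -/
def IsNonCrossing (p : PerfectMatching L) : Prop :=
  ∀ a b : Fin L, a < p.partner a → a < b → b < p.partner a → a < p.partner b ∧ p.partner b < p.partner a

/-- Planarity of a pairing is decidable (a finite check). [folklore] -/
instance instDecidableIsNonCrossing (p : PerfectMatching L) : Decidable (IsNonCrossing p) := by
  unfold IsNonCrossing
  infer_instance

/-- **Link patterns** on `L` sites: non-crossing pairings (the `0`-defect link diagrams, of
Catalan-number cardinality `C_{L/2}` for even `L`, spanning the left ideal `T I₀`;
Pearce–Rittenberg–de Gier–Nienhuis 2002, §2). [cite: PearceRittenbergDeGierNienhuis2002, §2] -/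
def LinkPattern (L : ℕ) : Type := {p : PerfectMatching L // IsNonCrossing p}

/-- There are finitely many link patterns on `L` sites (Catalan many for even `L`). [folklore] -/
instance LinkPattern.instFintype : Fintype (LinkPattern L) :=
  inferInstanceAs (Fintype {p : PerfectMatching L // IsNonCrossing p})

/-- Equality of link patterns is decidable. [folklore] -/
instance LinkPattern.instDecidableEq : DecidableEq (LinkPattern L) :=
  inferInstanceAs (DecidableEq {p : PerfectMatching L // IsNonCrossing p})

/-- The unique pairing of two sites. [folklore] -/
def PerfectMatching.arc : PerfectMatching 2 where
  partner i := if i = 0 then 1 else 0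
  partner_partner := by decide
  partner_ne := by decide

/-- The unique link pattern on two sites (one arc). [folklore] -/
def LinkPattern.arc : LinkPattern 2 :=
  ⟨PerfectMatching.arc, by decide⟩

/-! ### The Temperley–Lieb generators on the free module of pairings -/

section Module

variable (R : Type*) [CommRing R]

/-- **The Temperley–Lieb generator at the sites `a, b` with loop weight `δ`** on the free
`R`-module `PerfectMatching L →₀ R`: on the basis vector of a pairing `p`,
`e δ_p = δ • δ_p` if `p` pairs `a` with `b` (a contractible loop closes, weight `δ = q + q⁻¹`;
`δ = 1` at `q = e^{iπ/3}`, the percolation / `Q = 1` Potts point), and `e δ_p = δ_{connect p a b}`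
otherwise (Pearce–Rittenberg–de Gier–Nienhuis 2002, §2 (TL), (monoid)). Defined on ALL pairings
(the Brauer-type extension); the span of the link patterns is the sub-representation of interest.
[cite: PearceRittenbergDeGierNienhuis2002, §2 (TL) and (monoid)] -/
def tlGen (δ : R) (a b : Fin L) : (PerfectMatching L →₀ R) →ₗ[R] (PerfectMatching L →₀ R) :=
  Finsupp.lift (PerfectMatching L →₀ R) R (PerfectMatching L) fun p =>
    if p.partner a = b then δ • Finsupp.single p 1 else Finsupp.single (p.connect a b) 1

variable {R}

/-- The generator on a basis vector. [folklore] -/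
theorem tlGen_single (δ : R) (a b : Fin L) (p : PerfectMatching L) (c : R) :
    tlGen R δ a b (Finsupp.single p c) =
      c • (if p.partner a = b then δ • Finsupp.single p 1 else Finsupp.single (p.connect a b) 1) := by
  simp [tlGen, Finsupp.lift_apply, Finsupp.sum_single_index]

/-- **The first Temperley–Lieb relation `e² = δ e`** (`eᵢ² = (q + q⁻¹) eᵢ`,
Pearce–Rittenberg–de Gier–Nienhuis 2002, (TL)): after connecting `a ≠ b` they are partners, so a
second application only closes a loop. [cite: PearceRittenbergDeGierNienhuis2002, §2 (TL)] -/
theorem tlGen_comp_tlGen (δ : R) {a b : Fin L} (hab : a ≠ b) :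
    tlGen R δ a b ∘ₗ tlGen R δ a b = δ • tlGen R δ a b := by
  refine Finsupp.lhom_ext fun p c => ?_
  simp only [LinearMap.comp_apply, LinearMap.smul_apply, tlGen_single]
  by_cases h : p.partner a = b
  · simp only [h, if_true, map_smul, tlGen_single, smul_smul]
    ring_nf
  · simp only [h, if_false, map_smul, tlGen_single, PerfectMatching.connect_partner_left p hab,
      if_true, one_smul]
    rw [smul_comm]

/-- **The nearest-neighbour Temperley–Lieb generators** `eⱼ`, `j : Fin n`, on a strip of `L = n + 1`
sites, acting at the sites `j` and `j + 1` (`1 ≤ i ≤ L - 1` in the source's numbering).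
[cite: PearceRittenbergDeGierNienhuis2002, §2 (TL)] -/
def tlE {n : ℕ} (δ : R) (j : Fin n) : (PerfectMatching (n + 1) →₀ R) →ₗ[R] (PerfectMatching (n + 1) →₀ R) :=
  tlGen R δ (Fin.castSucc j) j.succ

/-- `eⱼ² = δ eⱼ` for the nearest-neighbour generators. [cite: PearceRittenbergDeGierNienhuis2002, §2 (TL)] -/
theorem tlE_comp_tlE {n : ℕ} (δ : R) (j : Fin n) : tlE δ j ∘ₗ tlE δ j = δ • tlE (R := R) δ j :=
  tlGen_comp_tlGen δ (Fin.castSucc_lt_succ (i := j)).ne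

/-- **The Temperley–Lieb Hamiltonian** `H = Σ_{j=1}^{L-1} (1 - eⱼ)` of the stochastic (loop weight
`δ = 1`) model on a strip of `L = n + 1` sites (Pearce–Rittenberg–de Gier–Nienhuis 2002, (ham): an
intensity matrix "closely related to the critical `Q = 1` Potts model (dense `O(n = 1)` or
Temperley–Lieb loop model)"); stated for general `δ`. [cite: PearceRittenbergDeGierNienhuis2002, §2 (ham)] -/
def tlHamiltonian {n : ℕ} (δ : R) : (PerfectMatching (n + 1) →₀ R) →ₗ[R] (PerfectMatching (n + 1) →₀ R) :=
  ∑ j : Fin n, (LinearMap.id - tlE δ j)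

/-- **The Temperley–Lieb relations** for a family of endomorphisms `e : Fin n → End V` with loop
weight `δ`: `eⱼ² = δ eⱼ`, `eⱼ e_{j±1} eⱼ = eⱼ`, and `eᵢ eⱼ = eⱼ eᵢ` for `|i - j| > 1`
(Pearce–Rittenberg–de Gier–Nienhuis 2002, (TL); Temperley–Lieb 1971). A predicate only; the
abstract algebra is not constructed here. [cite: PearceRittenbergDeGierNienhuis2002, §2 (TL)] -/
structure IsTemperleyLiebFamily {V : Type*} [AddCommGroup V] [Module R V] {n : ℕ} (δ : R)
    (e : Fin n → Module.End R V) : Prop where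
  /-- `eⱼ² = δ eⱼ`. -/
  sq : ∀ j, e j * e j = δ • e j
  /-- `eⱼ e_{j+1} eⱼ = eⱼ`. -/
  cubic_succ : ∀ (j k : Fin n), k.val = j.val + 1 → e j * e k * e j = e j
  /-- `e_{j+1} eⱼ e_{j+1} = e_{j+1}`. -/
  cubic_pred : ∀ (j k : Fin n), k.val = j.val + 1 → e k * e j * e k = e k
  /-- Far-apart generators commute. -/
  comm : ∀ (i j : Fin n), j.val + 1 < i.val → e i * e j = e j * e i

end Module

end TemperleyLieb

end Literature.Probability.LatticeModels

end
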